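import Summits.Parity.BatemanHorn.Theorems.SoloInformedTwinBalancedSplit

/-!
# SoloInformedTwinBalancedOnly — Hardy–Littlewood for prime pairs as a statement about the
# BALANCED divisor pairs alone, given the unbalanced estimate (F′) only

Solo unit `solo-Parity-informed` (ideation tier, informed mode), session 64; `paper.md` §20,
`SHARPEST-STATEMENT.md` §2 Theorem F, CLAIMS C137 (refines C120).

`SoloInformedTwinBalancedSplit` (C120) split the located twin sum
`T(x; y) = ∑_{n ≤ x} ∑_{e ∣ n(n+2), e > y} μ(e) log² e` over divisor pairs `(e₁ ∣ n, e₂ ∣ n+2)` as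
`T = U + W + R` — unbalanced pairs `min(e₁,e₂) ≤ z`, balanced window `min > z, e₁e₂ ≤ Y`, balanced
far tail `min > z, e₁e₂ > Y` — and derived `π₂(x) ~ 2C₂x/log²x ⟺ R = o(x)` under TWO typed prose
hypotheses: `hU` (= (F′), paper.md Thm 20.1; inputs: Bombieri–Vinogradov for `μ` and for
`μ ⋆ 1`-convolutions [BFI86, Thm 0(b)], Siegel–Walfisz — classical, citable) and `hW` (= (F),
paper.md Thm 20.9, `Y = x^{1+η}`, `η < 1/15`; input: [Ir14, Thm 1.3] ADAPTED to Möbius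
coefficients in paper.md App. 20.A — a written-out but unpublished adaptation).

This file separates the two premises.  Every term of `T` carries the indicator `𝟙[y < e₁e₂]`
(`twinPairTerm`), so at level `Y := y` the balanced window is EMPTY, identically in `x, z`:

* `twinBalancedWindowSum_eq_zero_of_le` — `W(x; y, z, Y) = 0` whenever `Y ≤ y`;
* `twinLocatedSum_eq_unbalanced_add_balanced` — the TWO-way split
  `T(x; y) = U(x; y, z) + B(x; y, z)` for all `x, y, z`, where the BALANCED PART is
  `B(x; y, z) := twinBalancedFarSum x y z y
     = ∑_{min(e₁,e₂) > z, e₁e₂ > y} μ(e₁) μ(e₂) log²(e₁e₂) N(e₁,e₂;x)`;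
* `twinBalancedSum_eq_window_add_far` — `B(x; y, z) = W(x; y, z, Y) + R(x; y, z, Y)` for EVERY
  level `Y` (so (F) is exactly the statement that refines `B` to `R`);
* `twinPrime_iff_balancedSum_isLittleO` — for every admissible cut `y` (`y → ∞`,
  `y log³ y = o(x)`) and every balance threshold `z`, under `hU` ALONE:
  `π₂(x) ~ 2C₂x/log²x ⟺ B = o(x)`;
* `twinPrime_iff_balancedSum_rpow` — the instance `y = ⌊x^{1-ε}⌋`, `z = ⌊x^{1/2-ε₀}⌋`:
  under (F′) alone, HL₂ ⟺
  `∑_{e₁,e₂ > x^{1/2-ε₀}, e₁e₂ > x^{1-ε}} μ(e₁) μ(e₂) log²(e₁e₂) N(e₁,e₂;x) = o(x)`;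
* `balancedSum_isLittleO_iff_farSum_isLittleO` — under `hW` at a level `Y`, `B = o(x) ⟺ R = o(x)`
  (how C120's headline is recovered from this one).

Reading.  The machine-checked equivalence `HL₂ ⟺ (balanced pairs beyond the cut) = o(x)` rests on
ONE prose premise, (F′), whose inputs are published theorems; the second prose premise (F) — the
only place the unpublished `μ`-adaptation of [Ir14] enters — is the further statement that the part
`x^{1-ε} < e₁e₂ ≤ x^{1+η}` of the balanced sum is itself `o(x)`, shrinking `B` to the far tail `R`
of C120/C125–C129.  Nothing analytic is proved here; no new definitions.
-/

namespace Summit.Parity.BatemanHorn.Theorems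

open Finset Filter Asymptotics ArithmeticFunction
open scoped ArithmeticFunction.Moebius
open Literature.NumberTheory.Sieve

/-! ### 1. The window below the cut is empty -/

/-- With a level `Y ≤ y` the balanced window vanishes identically: each of its pairs has
`e₁e₂ ≤ Y ≤ y`, while `twinPairTerm x y e₁ e₂` carries the indicator `𝟙[y < e₁e₂]`. -/
theorem twinBalancedWindowSum_eq_zero_of_le (x z : ℕ) {y Y : ℕ} (hY : Y ≤ y) :
    twinBalancedWindowSum x y z Y = 0 := by
  refine sum_eq_zero fun e₁ _ => sum_eq_zero fun e₂ _ => ?_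
  by_cases h : z < min e₁ e₂ ∧ e₁ * e₂ ≤ Y
  · have h' : ¬ y < e₁ * e₂ := not_lt.mpr (h.2.trans hY)
    rw [if_pos h, twinPairTerm, if_neg h', zero_mul]
  · rw [if_neg h]

/-- In particular the window at level `Y = y` is `0`. -/
theorem twinBalancedWindowSum_self_eq_zero (x y z : ℕ) : twinBalancedWindowSum x y z y = 0 :=
  twinBalancedWindowSum_eq_zero_of_le x z le_rfl

/-! ### 2. The two-way split `T = U + B` and the refinement `B = W + R` -/

/-- **Two-way split.**  For all `x, y, z`:
`T(x; y) = U(x; y, z) + B(x; y, z)`, where `B(x; y, z) = twinBalancedFarSum x y z y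
= ∑_{min(e₁,e₂) > z, e₁e₂ > y} μ(e₁) μ(e₂) log²(e₁e₂) N(e₁,e₂;x)` is the BALANCED PART of the
located twin sum. -/
theorem twinLocatedSum_eq_unbalanced_add_balanced (x y z : ℕ) :
    twinLocatedSum x y = twinUnbalancedSum x y z + twinBalancedFarSum x y z y := by
  rw [twinLocatedSum_eq_unbalanced_add_window_add_far x y z y, twinBalancedWindowSum_self_eq_zero,
    add_zero]

/-- The balanced part splits at EVERY level `Y`: `B(x; y, z) = W(x; y, z, Y) + R(x; y, z, Y)`. -/
theorem twinBalancedSum_eq_window_add_far (x y z Y : ℕ) :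
    twinBalancedFarSum x y z y = twinBalancedWindowSum x y z Y + twinBalancedFarSum x y z Y := by
  have h₁ := twinLocatedSum_eq_unbalanced_add_window_add_far x y z Y
  have h₂ := twinLocatedSum_eq_unbalanced_add_balanced x y z
  linarith

/-- The balanced part at level `Y ≤ y` is the whole balanced part (monotone bookkeeping). -/
theorem twinBalancedFarSum_eq_balancedSum_of_le (x z : ℕ) {y Y : ℕ} (hY : Y ≤ y) :
    twinBalancedFarSum x y z Y = twinBalancedFarSum x y z y := by
  rw [twinBalancedSum_eq_window_add_far x y z Y, twinBalancedWindowSum_eq_zero_of_le x z hY,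
    zero_add]

/-! ### 3. HL₂ ⟺ balanced part `= o(x)`, given (F′) alone -/

/-- **HL₂ ⟺ balanced pairs, given (F′) ALONE.**  For every admissible cut `y : ℕ → ℕ`
(`y → ∞`, `y log³ y = o(x)`) and every balance threshold `z : ℕ → ℕ`: if the UNBALANCED pairs
(`min(e₁,e₂) ≤ z`) contribute `o(x)` to `T(x; y)` — hypothesis `hU`, the prose theorem (F′)
(paper.md Thm 20.1) TYPED, not proved here — then
`π₂(x) ~ 2C₂ x / log² x ⟺ ∑_{min(e₁,e₂) > z(x), e₁e₂ > y(x)} μ(e₁) μ(e₂) log²(e₁e₂) N(e₁,e₂;x) = o(x)`. -/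
theorem twinPrime_iff_balancedSum_isLittleO {y z : ℕ → ℕ} (hy : Tendsto y atTop atTop)
    (hy' : (fun x : ℕ => (y x : ℝ) * Real.log (y x) ^ 3) =o[atTop] fun x : ℕ => (x : ℝ))
    (hU : (fun x => twinUnbalancedSum x (y x) (z x)) =o[atTop] fun x : ℕ => (x : ℝ)) :
    (fun x : ℕ => (twinPrimeCount x : ℝ)) ~[atTop]
        (fun x : ℕ => 2 * twinPrimeConst * x / Real.log x ^ 2) ↔
      (fun x => twinBalancedFarSum x (y x) (z x) (y x)) =o[atTop] fun x : ℕ => (x : ℝ) := by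
  refine twinPrime_iff_balancedFarSum_isLittleO (Y := y) hy hy' hU ?_
  have h0 : (fun x => twinBalancedWindowSum x (y x) (z x) (y x)) = fun _ : ℕ => (0 : ℝ) :=
    funext fun x => twinBalancedWindowSum_self_eq_zero x (y x) (z x)
  rw [h0]
  exact isLittleO_zero _ _

/-- Unconditionally: `T(x; y) = o(x) ⟺ B(x; y, z) = o(x)` as soon as `U = o(x)` (no cut
hypothesis needed for this step). -/
theorem twinLocatedSum_isLittleO_iff_balancedSum {y z : ℕ → ℕ}
    (hU : (fun x => twinUnbalancedSum x (y x) (z x)) =o[atTop] fun x : ℕ => (x : ℝ)) :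
    (fun x => twinLocatedSum x (y x)) =o[atTop] (fun x : ℕ => (x : ℝ)) ↔
      (fun x => twinBalancedFarSum x (y x) (z x) (y x)) =o[atTop] fun x : ℕ => (x : ℝ) := by
  refine twinLocatedSum_isLittleO_iff_balancedFarSum y z y hU ?_
  have h0 : (fun x => twinBalancedWindowSum x (y x) (z x) (y x)) = fun _ : ℕ => (0 : ℝ) :=
    funext fun x => twinBalancedWindowSum_self_eq_zero x (y x) (z x)
  rw [h0]
  exact isLittleO_zero _ _

/-- How (F) refines the statement: under `hW` (the balanced window up to level `Y` is `o(x)`),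
`B = o(x) ⟺ R = o(x)`. -/
theorem balancedSum_isLittleO_iff_farSum_isLittleO {y z Y : ℕ → ℕ}
    (hW : (fun x => twinBalancedWindowSum x (y x) (z x) (Y x)) =o[atTop] fun x : ℕ => (x : ℝ)) :
    (fun x => twinBalancedFarSum x (y x) (z x) (y x)) =o[atTop] (fun x : ℕ => (x : ℝ)) ↔
      (fun x => twinBalancedFarSum x (y x) (z x) (Y x)) =o[atTop] fun x : ℕ => (x : ℝ) := by
  have hB : (fun x => twinBalancedFarSum x (y x) (z x) (y x))
      = fun x => twinBalancedWindowSum x (y x) (z x) (Y x) + twinBalancedFarSum x (y x) (z x) (Y x) :=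
    funext fun x => twinBalancedSum_eq_window_add_far x (y x) (z x) (Y x)
  constructor
  · intro h
    have hR : (fun x => twinBalancedFarSum x (y x) (z x) (Y x))
        = fun x => twinBalancedFarSum x (y x) (z x) (y x) - twinBalancedWindowSum x (y x) (z x) (Y x) :=
      funext fun x => by rw [twinBalancedSum_eq_window_add_far x (y x) (z x) (Y x)]; ring
    rw [hR]
    exact h.sub hW
  · intro h
    rw [hB]
    exact hW.add h

/-! ### 4. The instance with the prose parameters -/

/-- **Typed corollary with the prose cut and balance threshold, ONE prose premise.**
For `0 < ε < 1` and any `ε₀`, under (F′) = `hU` (paper.md Thm 20.1 for `y = ⌊x^{1-ε}⌋`,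
`z = ⌊x^{1/2-ε₀}⌋`; prose, NOT proved in the kernel):
`π₂(x) ~ 2C₂x/log²x ⟺ ∑_{e₁,e₂ > x^{1/2-ε₀}, e₁e₂ > x^{1-ε}} μ(e₁) μ(e₂) log²(e₁e₂) N(e₁,e₂;x) = o(x)`. -/
theorem twinPrime_iff_balancedSum_rpow {ε : ℝ} (hε : 0 < ε) (hε1 : ε < 1) (ε₀ : ℝ)
    (hU : (fun x => twinUnbalancedSum x (rpowCut ε x) (balanceCut ε₀ x))
      =o[atTop] fun x : ℕ => (x : ℝ)) :
    (fun x : ℕ => (twinPrimeCount x : ℝ)) ~[atTop]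
        (fun x : ℕ => 2 * twinPrimeConst * x / Real.log x ^ 2) ↔
      (fun x => twinBalancedFarSum x (rpowCut ε x) (balanceCut ε₀ x) (rpowCut ε x))
        =o[atTop] fun x : ℕ => (x : ℝ) :=
  twinPrime_iff_balancedSum_isLittleO (y := rpowCut ε) (z := balanceCut ε₀)
    (tendsto_rpowCut_atTop hε1) (rpowCut_mul_log_pow_isLittleO hε hε1 3) hU

/-- With the prose parameters the balanced part is the window up to `x^{1+η}` plus the far tail of
C120, for every `η` (identity). -/
theorem twinBalancedSum_rpowCut_eq (ε ε₀ η : ℝ) (x : ℕ) :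
    twinBalancedFarSum x (rpowCut ε x) (balanceCut ε₀ x) (rpowCut ε x)
      = twinBalancedWindowSum x (rpowCut ε x) (balanceCut ε₀ x) (productLevel η x)
        + twinBalancedFarSum x (rpowCut ε x) (balanceCut ε₀ x) (productLevel η x) :=
  twinBalancedSum_eq_window_add_far _ _ _ _

end Summit.Parity.BatemanHorn.Theorems
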